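import Mathlib.GroupTheory.SemidirectProduct
import Mathlib.GroupTheory.Index
import Mathlib.Data.Fintype.Perm
import Literature.RepresentationTheory.FiniteGroups.SubgroupIndexDegreeBound
import Literature.RepresentationTheory.FiniteGroups.CharDegreePowSumProd
import Literature.Computability.AlgebraicComplexity.WreathCharDegreePowSum
import HarnessLib

/-!
# CKSU 2005, Lemma 2 for an arbitrary finite group `H`: `Σ_j c_j^s ≤ (n!)^{s−1}(Σ_k d_k^s)ⁿ` in `Sym_n ⋉ Hⁿ`

Topic `Literature/Computability/AlgebraicComplexity` (group-theoretic matrix multiplication); continues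
`WreathCharDegreePowSum.lean` (the ABELIAN case of the lemma, on the additive model `SymWreath H n`) and
resolves its `TODO(general form)`.  Source: H. Cohn, R. Kleinberg, B. Szegedy, C. Umans, *Group-theoretic
algorithms for matrix multiplication*, FOCS 2005 = arXiv:math/0511460 (held text `paper:arxiv-math_0511460`,
chunks p0003 L106 – p0004 L35, read this session):

"**Lemma 2.** Let `{d_k}` be the character degrees of a finite group `H` and let `{c_j}` be the character
degrees of `Sym_n ⋉ Hⁿ` (where `Sym_n` acts by permuting the coordinates). Then
`Σ_j c_j^ω ≤ (n!)^{ω−1} (Σ_k d_k^ω)ⁿ`."  Printed proof: abelian `H` — "the character degrees of `Sym_n ⋉ Hⁿ`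
are at most `n!` (which is the index of `Hⁿ` in `Sym_n ⋉ Hⁿ`) and … `Σ_j c_j² = |Sym_n ⋉ Hⁿ|`"; general
`H` — Clifford theory of `Sym_n ⋉ Hⁿ` ("Theorem 25.6 in [H]": every irreducible is
`Ind_{G_V ⋉ Hⁿ}^{Sym_n ⋉ Hⁿ}(W ⊗ V)`, of dimension `(n!/|G_V|) dim W dim V`, whence
`Σ_j c_j^ω = Σ_V (|G_V|/n!) Σ_W ((n!/|G_V|) dim W dim V)^ω ≤ (n!)^{ω−1} Σ_V dim(V)^ω = (n!)^{ω−1}(Σ_k d_k^ω)ⁿ`").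

## Formalisation

* `permAct H n : Sym_n →* MulAut (Hⁿ)` — "`Sym_n` acts on `Hⁿ` … by permuting the coordinates according
  to `(h^π)ᵢ = h_{π(i)}`", as the left action `π · h = h^{π⁻¹}`, `(π · h) i = h (π⁻¹ i)`;
* `PermWreath H n := Hⁿ ⋊[permAct] Sym_n` (Mathlib `SemidirectProduct`) — the group `Sym_n ⋉ Hⁿ` of the
  lemma for an ARBITRARY group `H`, with CKSU's law `hπ · h'π' = h (h')^{π⁻¹} ππ'` (`PermWreath.mul_left`);
  for abelian `H` it is the tree's additive model: `SymWreath.toPermWreath : SymWreath A n ≃* PermWreath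
  (Multiplicative A) n`; `PermWreath.card`: `|Sym_n ⋉ Hⁿ| = |H|ⁿ · n!`; `PermWreath.index_base`: the base
  `Hⁿ = ker(hπ ↦ π)` has index `n!` and is `≅ Hⁿ` (`PermWreath.baseMulEquiv`).
* `CohnKleinbergSzegedyUmans2005_lemma2` — **Lemma 2 for every finite group `H` and every real `s ≥ 2`**:
  `charDegreePowSum (PermWreath H n) s ≤ (n!)^{s−1} · (charDegreePowSum H s)ⁿ`, and `…_omega` at `s = ω`.
  ROUTE (deviating from the printed Clifford-theory proof, which would need Huppert Thm. 25.6): the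
  general-subgroup inequality `Σ_{χ∈Irr G} χ(1)^s ≤ [G:N]^{s−1} Σ_{θ∈Irr N} θ(1)^s`
  (`charDegreePowSum_le_index_rpow_mul`, from James–Liebeck Prop. 20.4 — exactly the printed abelian
  argument "`n!` is the index of `Hⁿ`", which now suffices in general) with `N = Hⁿ`, `[G:N] = n!`, and
  `Σ_{Irr(Hⁿ)} θ(1)^s = (Σ_k d_k^s)ⁿ` (`charDegreePowSum_pi_fin`, James–Liebeck Thm. 19.18).

All theorems; two definitions (`permAct`, `PermWreath`); no named fact.  (Thm. 7.1/Lemma 7.2/Thm. 5.5 for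
non-abelian `H`, which use this lemma, need the multiplicative STPP sets in `PermWreath`; not in this file.)

## References

* [CohnKleinbergSzegedyUmans2005] H. Cohn, R. Kleinberg, B. Szegedy, C. Umans, FOCS 2005, 379–388 =
  arXiv:math/0511460: Lemma 2 (arXiv numbering; p. 3 of the held text) with proof; §7 (the group
  `Sym_n ⋉ Hⁿ`, before Thm. 7.1 = arXiv Thm. 38).
* [JamesLiebeck2001] G. James, M. Liebeck, *Representations and Characters of Groups*, 2nd ed. (2001),
  Prop. 20.4, Thm. 19.18 (the tools, via the two imported files).
-/

noncomputable section

namespace Literature.Computability.AlgebraicComplexity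

open Finset Literature.RepresentationTheory.FiniteGroups

/-! ### The group `Sym_n ⋉ Hⁿ` for an arbitrary group `H` -/

/-- **`Sym_n` acting on `Hⁿ` by permuting the coordinates** — CKSU's right action `(h^π)ᵢ = h_{π(i)}`
written as the left action `π · h := h^{π⁻¹}`, `(π · h) i = h (π⁻¹ i)`, by group automorphisms of `Hⁿ`.
[cite: CohnKleinbergSzegedyUmans2005, §7 (before Thm. 7.1 = arXiv Thm. 38)] -/
def permAct (H : Type*) [Group H] (n : ℕ) : Equiv.Perm (Fin n) →* MulAut (Fin n → H) where
  toFun π :=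
    { toFun := fun h i => h (π⁻¹ i)
      invFun := fun h i => h (π i)
      left_inv := fun h => funext fun i => by simp
      right_inv := fun h => funext fun i => by simp
      map_mul' := fun _ _ => rfl }
  map_one' := by ext h i; simp
  map_mul' π σ := by ext h i; simp [mul_inv_rev]

/-- Unfolding lemma: `(π · h) i = h (π⁻¹ i)`. [cite: CohnKleinbergSzegedyUmans2005, §7 (before Thm. 7.1 = arXiv Thm. 38)] -/
@[simp] theorem permAct_apply {H : Type*} [Group H] {n : ℕ} (π : Equiv.Perm (Fin n)) (h : Fin n → H)
    (i : Fin n) : permAct H n π h i = h (π⁻¹ i) := rfl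

/-- Unfolding lemma for the inverse automorphism: `(π⁻¹ · h) i = h (π i)`, i.e. `h^π`.
[cite: CohnKleinbergSzegedyUmans2005, §7 (before Thm. 7.1 = arXiv Thm. 38)] -/
@[simp] theorem permAct_symm_apply {H : Type*} [Group H] {n : ℕ} (π : Equiv.Perm (Fin n))
    (h : Fin n → H) (i : Fin n) : (permAct H n π).symm h i = h (π i) := rfl

/-- **`Sym_n ⋉ Hⁿ`** for an arbitrary group `H` ("define `G = Sym_n ⋉ Hⁿ`, where the symmetric group `Sym_n`
acts on `Hⁿ` from the right by permuting the coordinates according to `(h^π)ᵢ = h_{π(i)}`. We write elements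
of `G` as `hπ` with `h ∈ Hⁿ` and `π ∈ Sym_n`"): Mathlib's semidirect product `Hⁿ ⋊[permAct] Sym_n`, elements
`⟨h, π⟩`, law `hπ · h'π' = h (h')^{π⁻¹} ππ'`.  For abelian `H` this is the tree's additive model `SymWreath`
(`SymWreath.toPermWreath`). [cite: CohnKleinbergSzegedyUmans2005, §7 (before Thm. 7.1 = arXiv Thm. 38)] -/
abbrev PermWreath (H : Type*) [Group H] (n : ℕ) : Type _ :=
  (Fin n → H) ⋊[permAct H n] Equiv.Perm (Fin n)

namespace PermWreath

variable {H : Type*} [Group H] {n : ℕ}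

/-- Component formula of the law `hπ · h'π' = h (h')^{π⁻¹} ππ'`: `(hπ · h'π')ᵢ = hᵢ h'_{π⁻¹ i}`.
[cite: CohnKleinbergSzegedyUmans2005, §7 (before Thm. 7.1 = arXiv Thm. 38)] -/
theorem mul_left (a b : PermWreath H n) (i : Fin n) : (a * b).left i = a.left i * b.left (a.right⁻¹ i) := rfl

/-- Component formula: the `Sym_n`-components multiply. [cite: CohnKleinbergSzegedyUmans2005, §7 (before Thm. 7.1 = arXiv Thm. 38)] -/
theorem mul_right (a b : PermWreath H n) : (a * b).right = a.right * b.right := rfl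

/-- `Sym_n ⋉ Hⁿ` is finite for finite `H` (as a set it is `Hⁿ × Sym_n`). [folklore] -/
instance [Finite H] : Finite (PermWreath H n) := Finite.of_equiv _ SemidirectProduct.equivProd.symm

/-- `|Sym_n ⋉ Hⁿ| = |H|ⁿ · n!`. [cite: CohnKleinbergSzegedyUmans2005, Lemma 2 (arXiv numbering), proof] -/
theorem card [Finite H] : Nat.card (PermWreath H n) = Nat.card H ^ n * n.factorial := by
  rw [SemidirectProduct.card, Nat.card_pi, Finset.prod_const, Finset.card_univ, Fintype.card_fin,
    Nat.card_eq_fintype_card (α := Equiv.Perm (Fin n)), Fintype.card_perm, Fintype.card_fin]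

/-- The base subgroup `Hⁿ = {h·1} = ker(hπ ↦ π)` of `Sym_n ⋉ Hⁿ`. [cite: CohnKleinbergSzegedyUmans2005, Lemma 2 (arXiv numbering), proof] -/
abbrev base (H : Type*) [Group H] (n : ℕ) : Subgroup (PermWreath H n) :=
  (SemidirectProduct.rightHom : PermWreath H n →* Equiv.Perm (Fin n)).ker

/-- The base subgroup is (isomorphic to) `Hⁿ`. [cite: CohnKleinbergSzegedyUmans2005, Lemma 2 (arXiv numbering), proof] -/
def baseMulEquiv (H : Type*) [Group H] (n : ℕ) : base H n ≃* (Fin n → H) :=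
  ((MonoidHom.ofInjective SemidirectProduct.inl_injective).trans
    (MulEquiv.subgroupCongr SemidirectProduct.range_inl_eq_ker_rightHom)).symm

/-- "**`n!` … is the index of `Hⁿ` in `Sym_n ⋉ Hⁿ`**" (CKSU, proof of Lemma 2).
[cite: CohnKleinbergSzegedyUmans2005, Lemma 2 (arXiv numbering), proof] -/
theorem index_base (H : Type*) [Group H] (n : ℕ) : (base H n).index = n.factorial := by
  rw [Subgroup.index_ker, MonoidHom.range_eq_top_of_surjective _ SemidirectProduct.rightHom_surjective,
    Subgroup.card_top, Nat.card_eq_fintype_card (α := Equiv.Perm (Fin n)), Fintype.card_perm, Fintype.card_fin]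

end PermWreath

/-- For an (additive) abelian group `A`, the tree's model `SymWreath A n` of `Sym_n ⋉ Aⁿ`
(`STPPWreathTPP.lean`) **is** `PermWreath (Multiplicative A) n`: same underlying pairs, same law.
[cite: CohnKleinbergSzegedyUmans2005, §7 (before Thm. 7.1 = arXiv Thm. 38)] -/
def SymWreath.toPermWreath (A : Type*) [AddCommGroup A] (n : ℕ) :
    SymWreath A n ≃* PermWreath (Multiplicative A) n where
  toFun w := ⟨fun i => Multiplicative.ofAdd (w.left i), w.right⟩
  invFun w := ⟨fun i => Multiplicative.toAdd (w.left i), w.right⟩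
  left_inv w := by ext i <;> simp
  right_inv w := by ext i <;> simp
  map_mul' a b := by ext i <;> simp [PermWreath.mul_left, ofAdd_add]

/-! ### Lemma 2 for arbitrary `H` -/

/-- **Cohn–Kleinberg–Szegedy–Umans 2005, Lemma 2 (arXiv numbering), for an ARBITRARY finite group `H`**
and every real exponent `s ≥ 2`: the character degrees `c_j` of `Sym_n ⋉ Hⁿ` and `d_k` of `H` satisfy
`Σ_j c_j^s ≤ (n!)^{s−1} (Σ_k d_k^s)ⁿ`.  Proof (our route, replacing the printed Clifford theory by the
printed abelian argument made general): `Σ_{Irr G} χ(1)^s ≤ [G:N]^{s−1} Σ_{Irr N} θ(1)^s`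
(`charDegreePowSum_le_index_rpow_mul`) for the base `N = Hⁿ` of index `n!` (`PermWreath.index_base`), and
`Σ_{Irr(Hⁿ)} θ(1)^s = (Σ_k d_k^s)ⁿ` (`charDegreePowSum_pi_fin`).
[cite: CohnKleinbergSzegedyUmans2005, Lemma 2 (arXiv numbering)] -/
theorem CohnKleinbergSzegedyUmans2005_lemma2 {H : Type} [Group H] [Finite H] (n : ℕ) {s : ℝ} (hs : 2 ≤ s) :
    charDegreePowSum (PermWreath H n) s ≤ (n.factorial : ℝ) ^ (s - 1) * charDegreePowSum H s ^ n := by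
  have h := charDegreePowSum_le_index_rpow_mul (PermWreath.base H n) hs
  rw [PermWreath.index_base, charDegreePowSum_congr (PermWreath.baseMulEquiv H n) s,
    charDegreePowSum_pi_fin] at h
  exact h

/-- CKSU's Lemma 2 (arbitrary finite `H`) at the exponent it is printed with, `s = ω`:
`Σ_j c_j^ω ≤ (n!)^{ω−1} (Σ_k d_k^ω)ⁿ` for `Sym_n ⋉ Hⁿ`. [cite: CohnKleinbergSzegedyUmans2005, Lemma 2 (arXiv numbering)] -/
theorem CohnKleinbergSzegedyUmans2005_lemma2_omega {H : Type} [Group H] [Finite H] (n : ℕ) :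
    charDegreePowSum (PermWreath H n) (omega ℂ) ≤
      (n.factorial : ℝ) ^ (omega ℂ - 1) * charDegreePowSum H (omega ℂ) ^ n :=
  CohnKleinbergSzegedyUmans2005_lemma2 n (omega_two_le ℂ)

end Literature.Computability.AlgebraicComplexity

end
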